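import Literature.RepresentationTheory.Kovacevic2021.SU21ModulesFromKTypes
import HarnessLib

/-!
# Kovačević's `SU(2,1)`-modules: the `K`-type decomposition and multiplicity one

Topic `RepresentationTheory/Kovacevic2021`; namespace `Literature.RepresentationTheory.Kovacevic2021`.
Sequel to `SU21ModulesFromKTypes` (the `(𝔤,K)`-modules of `SU(2,1)` built from Kovačević's
"`K`-types as points" data `SU21Datum` [Kovacevic2021, §3 Def 1, Thm 1, Thm 2]); theorems and
definitions with bodies only, no named fact.

Verbatim [corpus: paper:arxiv-1810.01752 p0005, §3 Def 1]: "We denote `K` modules by `V_{nm}` where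
`n` is the dimension of the space `V_{nm}` and `m` is the scalar by which `Z=H_α+2H_β` acts on that
space. Let `{v_{nm}^k}`, `k∈{1,2,…,n}` be a basis for `V_{nm}` such that
`ℂ v_{nm}^k = V_{nm} ∩ V_{n+1-2k}` where `V_i` are weight subspaces … (`H_α.v_{nm}^k=(n+1-2k)v_{nm}^k`,
`X_α.v_{nm}^k = -(k-1)v_{nm}^{k-1}` …)." and "Since `dim 𝔞 = 1`, we know that the multiplicity of `K`
modules `V_{nm}` is 1".

## What is proved (for an arbitrary datum `𝒟 : SU21Datum`, module `V = 𝒟.V`)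

* coordinates: `vec_apply`, the diagonal actions `Ha_apply`, `Hb_apply`, `Z_apply` and the
  lowering of the index by `X_α` (`Xa_apply_pred`);
* the `K`-type `V_{n,m} = Ktype n m` is the coordinate subspace on the labels `(n,m,·)`
  (`Ktype_eq_supported`), it is finite-dimensional of dimension **`dim V_{n,m} = n`** for `(n,m) ∈ S`
  (`finrank_Ktype_of_mem`; `= 0` otherwise, `finrank_Ktype_of_not_mem`), the `K`-types are
  independent and `V = ⊕_{(n,m)} V_{n,m}` is an internal direct sum (`iSupIndep_Ktype`,
  `isInternal_Ktype`) [Kovacevic2021, §3 Def 1: "`n` is the dimension of the space `V_{nm}`"];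
* **multiplicity one**: the space of `𝔨`-highest-weight vectors of type `(n,m)` —
  `X_α v = 0`, `H_α v = (n-1) v`, `Z v = m v` — is the line `ℂ u^1_{n,m}` (`hwSpace_eq_span`), of
  dimension `1` if `(n,m) ∈ S` and `0` otherwise (`finrank_hwSpace`); in Lie-bracket form
  `mem_hwSpace_iff_lie`.  This is the statement "the `K`-type `V_{n,m}` occurs in `V` with multiplicity
  exactly one for `(n,m) ∈ S` and does not occur otherwise", i.e. `dim Hom_𝔨(F_{(n,m)}, V) = [(n,m) ∈ S]`
  for the irreducible `𝔨 = 𝔤𝔩(2) ⊕ 𝔤𝔩(1)`-module `F_{(n,m)}` of highest weight `(n-1; m)`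
  [Kovacevic2021, §3, "the multiplicity of `K` modules `V_{nm}` is 1"; BorelWallach2000, VI 4.11 (9)].

NOT here: `Hom_𝔨(F, V)` as a Mathlib `LieModuleHom` space for an abstract irreducible `𝔨`-module `F`;
the Casimir and the irreducibility of the six modules (sibling files).

## References

* D. Kovačević, *Unitary `(𝔤,K)` modules of `SU(2,1)`*, Acta Math. Spalatensia 1 (2021) 105–125,
  §3 Def 1, Thm 1 (held: `paper:arxiv-1810.01752`, chunk p0005). [Kovacevic2021]
* A. Borel, N. Wallach (2000), VI 4.8–4.11, pp. 130–133 (chunks p0165–p0169). [BorelWallach2000]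
-/

noncomputable section

open Finsupp Module

namespace Literature.RepresentationTheory.Kovacevic2021

-- Mathlib idiom (Mathlib/Algebra/Lie/OfAssociative.lean): bracket on `Matrix`/`Module.End` = commutator.
attribute [local instance 100] LieRing.ofAssociativeRing

namespace SU21Datum

variable (𝒟 : SU21Datum)

/-! ### Coordinates -/

variable {𝒟} in
/-- `op f v` in coordinates: `(op f v)(s) = ∑_t v(t) · (f t)(s)`. [folklore] -/
private theorem op_apply (f : ℤ → ℤ → ℤ → 𝒟.V) (v : 𝒟.V) (s : 𝒟.Idx) :
    𝒟.op f v s = v.sum fun t c => c * f t.1.1 t.1.2.1 t.1.2.2 s := by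
  rw [op, Finsupp.linearCombination_apply, Finsupp.sum_apply]
  rfl

variable {𝒟} in
/-- the basis vector `u^k_{n,m}` in coordinates: the indicator of the label `(n,m,k)`.
[cite: Kovacevic2021, §3 Def 1] -/
theorem vec_apply (n m k : ℤ) (s : 𝒟.Idx) : 𝒟.vec n m k s = if (n, m, k) = s.1 then 1 else 0 := by
  by_cases h : (n, m) ∈ 𝒟.S ∧ 1 ≤ k ∧ k ≤ n
  · rw [vec_of_pos n m k h, Finsupp.single_apply]
    by_cases hs : (n, m, k) = s.1
    · rw [if_pos hs, if_pos (Subtype.ext hs)]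
    · rw [if_neg hs, if_neg fun h' => hs (congrArg Subtype.val h')]
  · rw [vec_of_neg n m k h, Finsupp.zero_apply, if_neg]
    intro hs
    have hs2 := s.2
    rw [← hs] at hs2
    exact h hs2

variable {𝒟} in
/-- the basis vector attached to an admissible label is the coordinate vector [cite: Kovacevic2021, §3 Def 1] -/
theorem vec_eq_single (t : 𝒟.Idx) : 𝒟.vec t.1.1 t.1.2.1 t.1.2.2 = Finsupp.single t 1 :=
  vec_of_pos _ _ _ t.2

variable {𝒟} in
/-- a diagonal operator in coordinates: if `f` multiplies each basis vector by a scalar `w`, then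
`(op f v)(s) = w(s) v(s)`. [folklore] -/
private theorem op_apply_of_diag (f : ℤ → ℤ → ℤ → 𝒟.V) (w : ℤ → ℤ → ℤ → ℂ)
    (hf : ∀ n m k, f n m k = w n m k • 𝒟.vec n m k) (v : 𝒟.V) (s : 𝒟.Idx) :
    𝒟.op f v s = w s.1.1 s.1.2.1 s.1.2.2 * v s := by
  rw [op_apply]
  have key : ∀ t : 𝒟.Idx, v t * f t.1.1 t.1.2.1 t.1.2.2 s = if t = s then w s.1.1 s.1.2.1 s.1.2.2 * v s else 0 := by
    intro t
    rw [hf, Finsupp.smul_apply, vec_apply, smul_eq_mul]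
    by_cases hts : t = s
    · subst hts
      rw [if_pos rfl, if_pos rfl, mul_one, mul_comm]
    · rw [if_neg hts, if_neg fun h => hts (Subtype.ext h), mul_zero, mul_zero]
  rw [Finsupp.sum, Finset.sum_congr rfl fun t _ => key t, Finset.sum_ite_eq' v.support s]
  split_ifs with hs
  · rfl
  · rw [Finsupp.notMem_support_iff.1 hs, mul_zero]

variable {𝒟} in
/-- `H_α` in coordinates: `(H_α v)(n,m,k) = (n+1-2k) v(n,m,k)`. [cite: Kovacevic2021, §3 Def 1] -/
theorem Ha_apply (v : 𝒟.V) (s : 𝒟.Idx) : 𝒟.Ha v s = ((s.1.1 : ℂ) + 1 - 2 * s.1.2.2) * v s :=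
  op_apply_of_diag _ (fun n _ k => (n : ℂ) + 1 - 2 * k) (fun _ _ _ => rfl) v s

variable {𝒟} in
/-- `H_β` in coordinates: `(H_β v)(n,m,k) = ((m-n-1+2k)/2) v(n,m,k)`. [cite: Kovacevic2021, §3 Def 1] -/
theorem Hb_apply (v : 𝒟.V) (s : 𝒟.Idx) :
    𝒟.Hb v s = (((s.1.2.1 : ℂ) - s.1.1 - 1 + 2 * s.1.2.2) / 2) * v s :=
  op_apply_of_diag _ (fun n m k => ((m : ℂ) - n - 1 + 2 * k) / 2) (fun _ _ _ => rfl) v s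

variable {𝒟} in
/-- `Z = H_α + 2H_β` in coordinates: `(Z v)(n,m,k) = m v(n,m,k)`. [cite: Kovacevic2021, §3 Def 1] -/
theorem Z_apply (v : 𝒟.V) (s : 𝒟.Idx) : (𝒟.Ha + (2 : ℂ) • 𝒟.Hb) v s = (s.1.2.1 : ℂ) * v s := by
  rw [LinearMap.add_apply, LinearMap.smul_apply, Finsupp.add_apply, Finsupp.smul_apply, Ha_apply,
    Hb_apply, smul_eq_mul]
  ring

variable {𝒟} in
/-- `X_α` lowers the index `k` by one, in coordinates: for admissible labels `s = (n,m,k)` and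
`t = (n,m,k+1)`, `(X_α v)(s) = -k(n-k) · v(t)`. [cite: Kovacevic2021, §3 Def 1] -/
theorem Xa_apply_pred (v : 𝒟.V) (s t : 𝒟.Idx) (hst : t.1 = (s.1.1, s.1.2.1, s.1.2.2 + 1)) :
    𝒟.Xa v s = -((s.1.2.2 : ℂ) * ((s.1.1 : ℂ) - s.1.2.2)) * v t := by
  rw [Xa, op_apply]
  have key : ∀ t' : 𝒟.Idx,
      v t' * ((-(((t'.1.2.2 : ℂ) - 1) * ((t'.1.1 : ℂ) + 1 - t'.1.2.2))) • 𝒟.vec t'.1.1 t'.1.2.1 (t'.1.2.2 - 1)) s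
        = if t' = t then -((s.1.2.2 : ℂ) * ((s.1.1 : ℂ) - s.1.2.2)) * v t else 0 := by
    intro t'
    rw [Finsupp.smul_apply, vec_apply, smul_eq_mul]
    by_cases ht : t' = t
    · subst ht
      rw [if_pos rfl, if_pos (by rw [hst]; simp), hst]
      push_cast
      ring
    · rw [if_neg ht, if_neg, mul_zero, mul_zero]
      intro h
      apply ht
      apply Subtype.ext
      rw [hst]
      obtain ⟨⟨n', m', k'⟩, _⟩ := t'
      have h1 := congrArg Prod.fst h
      have h2 := congrArg (fun x => x.2.1) h
      have h3 := congrArg (fun x => x.2.2) h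
      simp only at h1 h2 h3
      simp only [Prod.mk.injEq]
      omega
  rw [Finsupp.sum, Finset.sum_congr rfl fun t' _ => key t', Finset.sum_ite_eq' v.support t]
  split_ifs with ht
  · rfl
  · rw [Finsupp.notMem_support_iff.1 ht, mul_zero]

/-! ### The `K`-types as coordinate subspaces; dimension `n`; direct sum -/

/-- the labels `(n,m,k)` of the `K`-type `V_{n,m}` [cite: Kovacevic2021, §3 Def 1] -/
def fiber (n m : ℤ) : Set 𝒟.Idx := {t | t.1.1 = n ∧ t.1.2.1 = m}

variable {𝒟} in
/-- membership in the label fiber [cite: Kovacevic2021, §3 Def 1] -/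
@[simp] theorem mem_fiber {n m : ℤ} (t : 𝒟.Idx) : t ∈ 𝒟.fiber n m ↔ t.1.1 = n ∧ t.1.2.1 = m := Iff.rfl

/-- **`V_{n,m}` is the coordinate subspace on the labels `(n,m,·)`**, i.e. the span of the coordinate
vectors `u^k_{n,m}`, `1 ≤ k ≤ n`. [cite: Kovacevic2021, §3 Def 1] -/
theorem Ktype_eq_supported (n m : ℤ) : 𝒟.Ktype n m = Finsupp.supported ℂ ℂ (𝒟.fiber n m) := by
  apply le_antisymm
  · rw [Ktype, Submodule.span_le]
    rintro _ ⟨k, rfl⟩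
    change 𝒟.vec n m k ∈ _
    by_cases h : (n, m) ∈ 𝒟.S ∧ 1 ≤ k ∧ k ≤ n
    · rw [vec_of_pos n m k h]
      exact Finsupp.single_mem_supported ℂ 1 ⟨rfl, rfl⟩
    · rw [vec_of_neg n m k h]
      exact Submodule.zero_mem _
  · rw [Finsupp.supported_eq_span_single, Submodule.span_le]
    rintro _ ⟨t, ⟨htn, htm⟩, rfl⟩
    have h := 𝒟.vec_mem_Ktype t.1.1 t.1.2.1 t.1.2.2
    rw [vec_eq_single, htn, htm] at h
    exact h

variable {𝒟} in
/-- membership in `V_{n,m}` in coordinates: the support lies over `(n,m)` [cite: Kovacevic2021, §3 Def 1] -/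
theorem mem_Ktype_iff (n m : ℤ) (v : 𝒟.V) :
    v ∈ 𝒟.Ktype n m ↔ ∀ t ∈ v.support, t.1.1 = n ∧ t.1.2.1 = m := by
  rw [Ktype_eq_supported, Finsupp.mem_supported]
  exact Iff.rfl

variable {𝒟} in
/-- off `S` the label fiber is empty [cite: Kovacevic2021, §3 Def 1] -/
theorem fiber_eq_empty {n m : ℤ} (h : (n, m) ∉ 𝒟.S) : 𝒟.fiber n m = ∅ := by
  ext t
  simp only [mem_fiber, Set.mem_empty_iff_false, iff_false, not_and]
  intro hn hm
  apply h
  rw [← hn, ← hm]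
  exact t.2.1

variable {𝒟} in
/-- for `(n,m) ∈ S` the label fiber is `{(n,m,k) : 1 ≤ k ≤ n} ≃ [1, n]` [cite: Kovacevic2021, §3 Def 1] -/
def fiberEquiv {n m : ℤ} (h : (n, m) ∈ 𝒟.S) : 𝒟.fiber n m ≃ Set.Icc (1 : ℤ) n where
  toFun t := ⟨t.1.1.2.2, by
    obtain ⟨⟨⟨n', m', k'⟩, hS, hk, hkn⟩, hn, hm⟩ := t
    simp only at hn hm hk hkn ⊢
    subst hn
    exact ⟨hk, hkn⟩⟩
  invFun k := ⟨⟨(n, m, k.1), h, k.2.1, k.2.2⟩, rfl, rfl⟩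
  left_inv t := by
    obtain ⟨⟨⟨n', m', k'⟩, hS, hk, hkn⟩, hn, hm⟩ := t
    simp only at hn hm
    subst hn hm
    rfl
  right_inv k := rfl

variable {𝒟} in
/-- the label fibers are finite [cite: Kovacevic2021, §3 Def 1] -/
theorem fiber_finite (n m : ℤ) : (𝒟.fiber n m).Finite := by
  by_cases h : (n, m) ∈ 𝒟.S
  · haveI : Finite (Set.Icc (1 : ℤ) n) := (Set.finite_Icc 1 n).to_subtype
    exact Set.finite_coe_iff.1 (Finite.of_equiv _ (fiberEquiv h).symm)
  · rw [fiber_eq_empty h]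
    exact Set.finite_empty


/-- `V_{n,m}` is finite-dimensional. [cite: Kovacevic2021, §3 Def 1] -/
instance finiteDimensional_Ktype (n m : ℤ) : FiniteDimensional ℂ (𝒟.Ktype n m) := by
  rw [Ktype_eq_supported]
  haveI : Finite (𝒟.fiber n m) := (fiber_finite n m).to_subtype
  exact Module.Finite.equiv (Finsupp.supportedEquivFinsupp (𝒟.fiber n m)).symm

variable {𝒟} in
/-- **`dim V_{n,m} = n`** for a `K`-type `(n,m) ∈ S` of the datum (basis `u^1_{n,m}, …, u^n_{n,m}`).
[cite: Kovacevic2021, §3 Def 1] -/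
theorem finrank_Ktype_of_mem {n m : ℤ} (h : (n, m) ∈ 𝒟.S) : finrank ℂ (𝒟.Ktype n m) = n.toNat := by
  haveI : Fintype (𝒟.fiber n m) := Fintype.ofEquiv _ (fiberEquiv h).symm
  rw [Ktype_eq_supported, LinearEquiv.finrank_eq (Finsupp.supportedEquivFinsupp (𝒟.fiber n m)),
    Module.finrank_finsupp_self, Fintype.card_congr (fiberEquiv h)]
  have h1 := Int.card_fintype_Icc_of_le (a := 1) (b := n) (by have := 𝒟.one_le_of_mem h; omega)
  omega

variable {𝒟} in
/-- `dim V_{n,m} = 0` off `S`. [cite: Kovacevic2021, §3 Def 1] -/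
theorem finrank_Ktype_of_not_mem {n m : ℤ} (h : (n, m) ∉ 𝒟.S) : finrank ℂ (𝒟.Ktype n m) = 0 := by
  rw [𝒟.Ktype_eq_bot h, finrank_bot]

/-- **The `K`-types are independent**: `V_{n,m} ∩ ∑_{(n',m') ≠ (n,m)} V_{n',m'} = 0`.
[cite: Kovacevic2021, §3 Def 1] -/
theorem iSupIndep_Ktype : iSupIndep fun p : ℤ × ℤ => 𝒟.Ktype p.1 p.2 := by
  rw [iSupIndep_def]
  intro p
  have hle : (⨆ (j : ℤ × ℤ) (_ : j ≠ p), 𝒟.Ktype j.1 j.2) ≤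
      Finsupp.supported ℂ ℂ {t : 𝒟.Idx | (t.1.1, t.1.2.1) ≠ p} :=
    iSup₂_le fun j hj => by
      rw [Ktype_eq_supported]
      refine Finsupp.supported_mono fun t ht => ?_
      obtain ⟨htn, htm⟩ := ht
      show (t.1.1, t.1.2.1) ≠ p
      rw [htn, htm]
      exact fun h => hj (Prod.ext (congrArg Prod.fst h) (congrArg Prod.snd h))
  refine Disjoint.mono_right hle ?_
  rw [Ktype_eq_supported]
  refine Finsupp.disjoint_supported_supported (Set.disjoint_left.2 fun t ht ht' => ?_)
  obtain ⟨htn, htm⟩ := ht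
  exact ht' (Prod.ext htn htm)

/-- **`V = ⊕_{(n,m)} V_{n,m}`** (internal direct sum over all labels; the summands off `S` are zero).
[cite: Kovacevic2021, §3 Def 1] -/
theorem isInternal_Ktype : DirectSum.IsInternal fun p : ℤ × ℤ => 𝒟.Ktype p.1 p.2 :=
  DirectSum.isInternal_submodule_of_iSupIndep_of_iSup_eq_top 𝒟.iSupIndep_Ktype 𝒟.iSup_Ktype

/-! ### Multiplicity one: the `𝔨`-highest-weight vectors of type `(n,m)` form the line `ℂ u^1_{n,m}` -/

/-- The space of **`𝔨`-highest-weight vectors of type `(n,m)`** in `V`: `X_α v = 0`, `H_α v = (n-1) v`,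
`Z v = m v` (`Z = H_α + 2H_β`); its dimension is the multiplicity of the `K`-type `V_{n,m}`
(`= F_{(n,m)}`, highest weight `(n-1; m)`) in `V`. [cite: Kovacevic2021, §3 Def 1] -/
def hwSpace (n m : ℤ) : Submodule ℂ 𝒟.V :=
  LinearMap.ker 𝒟.Xa ⊓ LinearMap.ker (𝒟.Ha - ((n : ℂ) - 1) • LinearMap.id)
    ⊓ LinearMap.ker (𝒟.Ha + (2 : ℂ) • 𝒟.Hb - (m : ℂ) • LinearMap.id)

variable {𝒟} in
/-- membership in `hwSpace n m`, operator form [cite: Kovacevic2021, §3 Def 1] -/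
theorem mem_hwSpace_iff {n m : ℤ} (v : 𝒟.V) :
    v ∈ 𝒟.hwSpace n m ↔
      𝒟.Xa v = 0 ∧ 𝒟.Ha v = ((n : ℂ) - 1) • v ∧ (𝒟.Ha + (2 : ℂ) • 𝒟.Hb) v = (m : ℂ) • v := by
  simp only [hwSpace, Submodule.mem_inf, LinearMap.mem_ker, LinearMap.sub_apply, LinearMap.smul_apply,
    LinearMap.id_apply, sub_eq_zero, and_assoc]

variable {𝒟} in
/-- membership in `hwSpace n m`, Lie-bracket form: `⁅E₀₁, v⁆ = 0`, `⁅E₀₀ - E₁₁, v⁆ = (n-1) v`,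
`⁅E₀₀ + E₁₁ - 2E₂₂, v⁆ = m v`. [cite: Kovacevic2021, §3 Def 1] -/
theorem mem_hwSpace_iff_lie {n m : ℤ} (v : 𝒟.V) :
    v ∈ 𝒟.hwSpace n m ↔
      ⁅E 0 1, v⁆ = 0 ∧ ⁅E 0 0 - E 1 1, v⁆ = ((n : ℂ) - 1) • v ∧
        ⁅E 0 0 + E 1 1 - (2 : ℂ) • E 2 2, v⁆ = (m : ℂ) • v := by
  rw [mem_hwSpace_iff, lie_def, lie_def, lie_def, ρfun_E, ρfun_Hα, ρfun_Z]

/-- `u^1_{n,m}` is a `𝔨`-highest-weight vector of type `(n,m)`. [cite: Kovacevic2021, §3 Def 1] -/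
theorem vec_one_mem_hwSpace (n m : ℤ) : 𝒟.vec n m 1 ∈ 𝒟.hwSpace n m := by
  rw [mem_hwSpace_iff, Xa_vec, LinearMap.add_apply, LinearMap.smul_apply, Ha_vec, Hb_vec, smul_smul,
    ← add_smul]
  refine ⟨by simp, ?_, ?_⟩
  · congr 1; push_cast; ring
  · congr 1; push_cast; ring

variable {𝒟} in
/-- the support of a `𝔨`-highest-weight vector of type `(n,m)` is contained in the single label
`(n,m,1)`: `X_α v = 0` kills every `u^k` with `k ≥ 2` (its `X_α`-image `-(k-1)(n+1-k) u^{k-1}` has a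
non-zero coefficient), and the `H_α`, `Z`-eigenvalues fix `(n,m)`. [cite: Kovacevic2021, §3 Def 1] -/
theorem apply_eq_of_mem_hwSpace {n m : ℤ} {v : 𝒟.V} (hv : v ∈ 𝒟.hwSpace n m) (t : 𝒟.Idx)
    (ht : t ∈ v.support) : t.1 = (n, m, 1) := by
  rw [mem_hwSpace_iff] at hv
  obtain ⟨hX, hH, hZ⟩ := hv
  have hvt : v t ≠ 0 := Finsupp.mem_support_iff.1 ht
  obtain ⟨⟨n', m', k'⟩, hS, hk, hkn⟩ := t
  simp only at hS hk hkn
  -- `k' = 1`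
  have hk1 : k' = 1 := by
    by_contra hk1
    let s : 𝒟.Idx := ⟨(n', m', k' - 1), hS, by simp only; omega, by simp only; omega⟩
    have h := Xa_apply_pred v s ⟨(n', m', k'), hS, hk, hkn⟩ (by simp [s])
    rw [hX, Finsupp.zero_apply] at h
    have h1 : -(((k' - 1 : ℤ) : ℂ) * ((n' : ℂ) - ((k' - 1 : ℤ) : ℂ))) ≠ 0 := by
      refine neg_ne_zero.2 (mul_ne_zero ?_ ?_)
      · exact_mod_cast (show (k' - 1 : ℤ) ≠ 0 by omega)
      · exact_mod_cast (show (n' - (k' - 1) : ℤ) ≠ 0 by omega)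
    exact hvt ((mul_eq_zero.1 h.symm).resolve_left h1)
  subst hk1
  -- `n' = n` from the `H_α`-eigenvalue, `m' = m` from the `Z`-eigenvalue
  have hn : n' = n := by
    have h := congrArg (fun w : 𝒟.V => w ⟨(n', m', 1), hS, hk, hkn⟩) hH
    simp only [Ha_apply, Finsupp.smul_apply, smul_eq_mul] at h
    have h' : ((n' : ℂ) - n) * v ⟨(n', m', 1), hS, hk, hkn⟩ = 0 := by linear_combination h
    have h'' : (n' : ℂ) - n = 0 := (mul_eq_zero.1 h').resolve_right hvt
    exact_mod_cast sub_eq_zero.1 h''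
  have hm : m' = m := by
    have h := congrArg (fun w : 𝒟.V => w ⟨(n', m', 1), hS, hk, hkn⟩) hZ
    simp only [Z_apply, Finsupp.smul_apply, smul_eq_mul] at h
    have h' : ((m' : ℂ) - m) * v ⟨(n', m', 1), hS, hk, hkn⟩ = 0 := by linear_combination h
    have h'' : (m' : ℂ) - m = 0 := (mul_eq_zero.1 h').resolve_right hvt
    exact_mod_cast sub_eq_zero.1 h''
  subst hn hm
  rfl

/-- **Multiplicity one.** The `𝔨`-highest-weight vectors of type `(n,m)` in `V` form the line
`ℂ u^1_{n,m}` (which is `0` if `(n,m) ∉ S`): the `K`-type `V_{n,m}` occurs in `V` exactly once for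
`(n,m) ∈ S` and not at all otherwise. [cite: Kovacevic2021, §3 Def 1 ("the multiplicity of `K` modules
`V_{nm}` is 1")] -/
theorem hwSpace_eq_span (n m : ℤ) : 𝒟.hwSpace n m = ℂ ∙ 𝒟.vec n m 1 := by
  refine le_antisymm (fun v hv => ?_) ?_
  · by_cases hS : (n, m) ∈ 𝒟.S
    · have hn := 𝒟.one_le_of_mem hS
      let s₀ : 𝒟.Idx := ⟨(n, m, 1), hS, le_rfl, hn⟩
      have hsub : v.support ⊆ {s₀} := fun t ht =>
        Finset.mem_singleton.2 (Subtype.ext (apply_eq_of_mem_hwSpace hv t ht))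
      rw [Finsupp.support_subset_singleton] at hsub
      rw [hsub, ← Finsupp.smul_single_one, vec_of_pos n m 1 ⟨hS, le_rfl, hn⟩]
      exact Submodule.smul_mem _ _ (Submodule.mem_span_singleton_self _)
    · have h0 : v = 0 := by
        rw [← Finsupp.support_eq_empty, Finset.eq_empty_iff_forall_notMem]
        intro t ht
        have h := apply_eq_of_mem_hwSpace hv t ht
        apply hS
        have h2 := t.2.1
        rw [h] at h2
        exact h2
      rw [h0]
      exact Submodule.zero_mem _
  · rw [Submodule.span_le, Set.singleton_subset_iff]
    exact 𝒟.vec_one_mem_hwSpace n m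

variable {𝒟} in
/-- **`dim {𝔨-highest-weight vectors of type (n,m)} = 1`** for `(n,m) ∈ S`.
[cite: Kovacevic2021, §3 Def 1] [cite: BorelWallach2000, VI Thm 4.11 (9)] -/
theorem finrank_hwSpace_of_mem {n m : ℤ} (h : (n, m) ∈ 𝒟.S) : finrank ℂ (𝒟.hwSpace n m) = 1 := by
  rw [hwSpace_eq_span]
  exact finrank_span_singleton (𝒟.vec_ne_zero ⟨h, le_rfl, 𝒟.one_le_of_mem h⟩)

variable {𝒟} in
/-- … and `= 0` for `(n,m) ∉ S` (the `K`-type does not occur). [cite: Kovacevic2021, §3 Def 1] -/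
theorem finrank_hwSpace_of_not_mem {n m : ℤ} (h : (n, m) ∉ 𝒟.S) : finrank ℂ (𝒟.hwSpace n m) = 0 := by
  rw [hwSpace_eq_span, vec_of_not_mem 1 h, Submodule.span_zero_singleton, finrank_bot]

open Classical in
/-- **The `K`-type multiplicity table of `V`**: `dim Hom_𝔨(F_{(n,m)}, V) = 1` if `(n,m) ∈ S`, else `0`
(in highest-weight-vector form). [cite: Kovacevic2021, §3 Def 1] [cite: BorelWallach2000, VI Thm 4.11 (9)] -/
theorem finrank_hwSpace (n m : ℤ) : finrank ℂ (𝒟.hwSpace n m) = if (n, m) ∈ 𝒟.S then 1 else 0 := by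
  split_ifs with h
  · exact finrank_hwSpace_of_mem h
  · exact finrank_hwSpace_of_not_mem h

end SU21Datum

end Literature.RepresentationTheory.Kovacevic2021
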